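/-
Copyright (c) 2026 The HodgeConjecture formalisation campaign. All rights reserved.
Released under Apache 2.0 license as described in the file LICENSE.
-/
import Summits.HodgeConjecture.HodgeConjecture.Theorems.K2E1SphericalEisensteinResidueCuspidalCMTwo   -- ★ p860098 R5 at `χ = 1`, constant section (the TEMPLATE of §1); brings the residue-function file, the Siegel indicator, mean zero, `⟪𝟙, ·⟫`
import Summits.HodgeConjecture.HodgeConjecture.Theorems.K2E1ChiEisensteinDetTwistU2                  -- ★ p861657 (this seat, S8 p07a): `residue_twist` (the `det`-twist of a pole letter)
import HarnessLib

/-!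
# THE RESIDUE OF A CONTINUED BOREL EISENSTEIN FAMILY OF `U(1,1)` AT `z = 1` IS A CONSTANT — FOR AN ARBITRARY SECTION, FROM THREE LETTERS
(Langlands' `L²` lemma at a general level `K′`; Mœglin–Waldspurger 1995, IV.1.11; Rogawski 1990, §13.3)

Cell `pub/hodgecm-mathlib`, R90-TF section S8 «ContSpec-n½» (R90-CS-plan (g0) deal «p12», verdict «T1 NOW» 16:05:50Z; ROAD `R90/S8/ROAD-S8B2.K2E1-p13-g3.md` §4, the
`K`-finite ∕ level-`K′` residue functional).  THEOREMS ONLY (no `def`, no `instance`, no notation, no named-fact hypothesis, no `sorry`); lane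
`--supports stmt-HodgeConjecture-24833 --as helper` (count-neutral, closes no socket).

THE POINT.  ★ p860098 `K2E1SphericalEisensteinResidueCuspidalCMTwo.residueValue_eq_const_cm_two` proves «`Res_{z=1} Ẽ(z)(g) = φ₀·r` for every `g`» for the CONSTANT
(`K_max`-spherical) section `φ₀`, by an `L²` argument whose three inputs are typed at `fun _ => φ₀`: (1) ★ `K2E1ContinuedEisensteinResidueConstantTermUTwo.
integrableOn_and_setIntegral_residueValue_sub_eq_zero` — the constant term of the residue function `g ↦ F g 1` is the constant `φ₀ r`; (AE) ★ `ae_eq_residueValue_sub_indicator` —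
the `L²` residue class of the truncated family is a.e. `F(·)1 − 𝟙[T < w]·φ₀r`; (3) ★ `K2E1SphericalEisensteinResidueOrthogonalCMTwo.horth_cm_two_of_letters` — that class (plus any
multiple of the Siegel indicator) is orthogonal to cusp forms.  THIS FILE re-types the ASSEMBLY for an ARBITRARY section (any level `K′`, any `K`-type) and an ARBITRARY constant `c`,
taking (1), (AE), (3) — with `φ₀ r ↦ c` — as the three LETTERS `hct`, `hResae`, `horth`; everything else (the residue function is continuous and left-`G(L⁺)`-invariant, the cusp
condition of `F(·)1 − c`, mean zero of cusp forms, `‖[ψ]‖² = ⟪Res + c•ind, [ψ]⟫ − c̄⟪𝟙, [ψ]⟫ = 0`, continuity ⇒ `ψ = 0` everywhere) is ★ p860098's proof VERBATIM.  The level-`K′` content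
— «the residue `Res_{z=1} M(z)φ₁` of the intertwined section is the CONSTANT function `c`», i.e. the Langlands quotient of `I_v(1)` at the top pole is `𝟙` at every place, ramified
`K′_v` included — enters OPENLY through the single constant `c` of `hct`∕`hResae` and is discharged by the T2 files of record (R90-CS-plan 16:05:50Z: T2-(i)
`K2E1ContinuedEisensteinResidueConstantTermLevelUTwo` generalises (1) from the scalar letter `hE3` to the level-`K′` constant-term letter `hE3′ : (Ẽ z)_B g = φ₁ g·H^z + ψ z g·H^{1−z}`,
`(z−1)ψ z g → c`; T2-(ii)/(iii) generalise (AE) and (3)).  With ★ p861657 (`det`-twist) the residue of the `Θ`-twisted family is then `c·Θ` (§2) — R5 of the ROAD for every level.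

CONTENTS (`G = U(Φ₂)_{L/L⁺}`, Mok's `quasiSplit L⁺ L c 2`; `𝔓₀ = (N(𝔸))` the one-radical Borel datum):
* §1 **`residueValue_eq_const_of_letters_cm_two`** — binders: ★ p860098's USED sub-package VERBATIM `(μ) [IsAutomorphicMeasure] {T} (Ec) {D} (hDo) {ρ} (hρ) (hρD) (hEd) (hE4) (hEbd)
  (hEcinv) (Fp) (hF) (hFE)` (its `ν 𝓕 h𝓕N h𝓕c φ₀ hT σ₀ hσD hDc hE2 hcres hE3 Fam hFd hFam hRes` feed ONLY the three φ₀-typed inputs and are therefore not repeated), then `(c : ℂ)`,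
  the LETTERS — (L-CT) `hct : ∀ ν′ [ν′.IsHaarMeasure] {𝓕′}, IsFundamentalDomain N(F) 𝓕′ ν′ → ∀ x, IntegrableOn (fun u => Fp (u·x) 1 − c) 𝓕′ ν′ ∧ ∫_{𝓕′} (Fp (u·x) 1 − c) dν′ = 0`
  (★ (1)'s conclusion, `φ₀ * r ↦ c`), (L-AE) `(Res) (hResae : Res =ᵐ fun x => Fp (out x)⁻¹ 1 − if T < supHeight x then c else 0)` (★ (AE)'s conclusion), (L-ORTH) `(ind) (hind) (horth :
  ∀ φ : cuspForms μ 𝔓₀, ⟪Res + c • ind, [φ]⟫ = 0)` (★ (3)'s conclusion at `𝔓₀`, `κ := c`) — ⊢ `∀ g, Fp g 1 = c`.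
* §2 **`residue_detTwist_eq_const_mul_of_letters_cm_two`** — the same letters (for the UNtwisted `Ẽ`) plus an automorphic character `Θ` and ANY pole letter `(Fp′, hF′, hFE′)` of `Ẽ·Θ`:
  `∀ g, Fp′ g 1 = c·Θ(g)` (★ p861657 `residue_twist`).

HONEST LABEL: HC_CM is proved only modulo the 7 printed citations (2 remaining named inputs: hLiu418 = `stmt-HodgeConjecture-24832`, h413 =
`stmt-HodgeConjecture-24833`) until rung 0 closes; REL ≠ ★ ≠ BUILT; count-neutral helper, closes no socket; the three letters are NOT discharged here.
-/

-- (for Claude) Library norms: see HarnessLib/Guide.lean. Problem-specific definitions are under review —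
-- flag anything that looks too strong or too weak.

set_option autoImplicit false
set_option linter.style.longLine false
set_option linter.dupNamespace false

noncomputable section

open MeasureTheory Measure NumberField IsDedekindDomain Set Filter Topology Metric
open scoped ENNReal NNReal InnerProductSpace ComplexConjugate
open Literature.NumberTheory.Automorphic Literature.NumberTheory.Automorphic.UnitaryGroup AdelicGroupData
open Summit.HodgeConjecture.HodgeConjecture.Cruxes.H413.K2E1BorelEisensteinU
open Summit.HodgeConjecture.HodgeConjecture.Cruxes.H413.K2E1BLBorelSpacesU2Defs
open Summit.HodgeConjecture.HodgeConjecture.Cruxes.H413.K2E1ContinuedEisensteinResidueFunctionUTwo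
open Summit.HodgeConjecture.HodgeConjecture.Cruxes.H413.K2E1SphericalEisensteinResidueOrthogonalU (memLp_quotFun_siegelIndicator)
open Summit.HodgeConjecture.HodgeConjecture.Cruxes.H413.K2E1CuspFormsMeanZeroSoftUCM (integral_eq_zero_of_mem_cuspForms_cm_two)
open Summit.HodgeConjecture.HodgeConjecture.Cruxes.H413.K2E1ConstantLineResidualU2 (inner_const_one_left)
open Summit.HodgeConjecture.HodgeConjecture.Cruxes.H413.K2E1ChiEisensteinDetTwistU2 (residue_twist)

namespace Summit.HodgeConjecture.HodgeConjecture.Cruxes.H413.K2E1EisensteinResidueLevelConstantU2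

variable (L : Type) [Field L] [NumberField L] [IsCMField L]
variable [MeasurableSpace (quasiSplit (↥(maximalRealSubfield L)) L (IsCMField.complexConj L) 2).Adelic] [BorelSpace (quasiSplit (↥(maximalRealSubfield L)) L (IsCMField.complexConj L) 2).Adelic]

/-! ## §1 Langlands' `L²` lemma for an arbitrary section, from the three letters -/

-- the statement carries ★ p860098's letter package (≈ 3 kB of binders); same class as the ★ template
/-- **THE RESIDUE AT `z = 1` OF A CONTINUED EISENSTEIN FAMILY OF `U(1,1)` IS THE CONSTANT `c` — FOR ANY SECTION, GIVEN THE THREE LETTERS.**  DATA: `μ` automorphic; the continued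
values `Ẽ = Ec` on an open `D ⊇ B(1,ρ)∖{1}` with (E1) `hEd`, (E4) `hE4`, (E2-bd) `hEbd`, left-`G(L⁺)`-invariance `hEcinv`; a pole letter `(Fp, hF, hFE)` (`F g` analytic at `1`,
`= (z−1)Ẽ(z)(g)` nearby); a constant `c`; (L-CT) `hct` — the constant term of the residue function `g ↦ F g 1` is `c` along EVERY Haar measure `ν′` of `N(𝔸)` and EVERY fundamental
domain `𝓕′` of `N(F)`; (L-AE) an `L²` class `Res` which is a.e. `F(x̃⁻¹)1 − 𝟙[T < w(x)]·c`; (L-ORTH) `Res + c•ind ⊥` every cusp form of the one-radical datum `(N(𝔸))`, `ind` the Siegel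
indicator class `𝟙[T < w]`.  CONCLUSION: `F g 1 = c` for every `g`.  Proof = ★ `residueValue_eq_const_cm_two` verbatim with its three `φ₀`-typed inputs replaced by the letters:
`ψ := F(·)1 − c` is a continuous cusp form, `[ψ] = Res + c•ind − c•𝟙` is `⊥` cusp forms and `⊥ 𝟙`, so `‖[ψ]‖² = 0`, `ψ = 0` a.e., hence everywhere.
[cite: MoeglinWaldspurger1995, IV.1.11] [cite: Langlands1976, §7] [cite: BernsteinLapid2019, §4 p. 10] -/
theorem residueValue_eq_const_of_letters_cm_two
    (μ : Measure (quasiSplit (↥(maximalRealSubfield L)) L (IsCMField.complexConj L) 2).automorphicQuotient) [(quasiSplit (↥(maximalRealSubfield L)) L (IsCMField.complexConj L) 2).IsAutomorphicMeasure μ]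
    {T : ℝ≥0}
    (Ec : ℂ → (quasiSplit (↥(maximalRealSubfield L)) L (IsCMField.complexConj L) 2).Adelic → ℂ) {D : Set ℂ} (hDo : IsOpen D)
    {ρ : ℝ} (hρ : 0 < ρ) (hρD : ∀ z : ℂ, z ≠ 1 → dist z 1 < ρ → z ∈ D)
    (hEd : ∀ g, DifferentiableOn ℂ (fun z => Ec z g) D) (hE4 : ∀ z ∈ D, Continuous (Ec z))
    (hEbd : ∀ z₀ ∈ D, ∀ K : Set (quasiSplit (↥(maximalRealSubfield L)) L (IsCMField.complexConj L) 2).Adelic, IsCompact K → ∃ V ∈ 𝓝 z₀, ∃ M : ℝ, ∀ z ∈ V, ∀ g ∈ K, ‖Ec z g‖ ≤ M)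
    (hEcinv : ∀ z ∈ D, ∀ (γ : (quasiSplit (↥(maximalRealSubfield L)) L (IsCMField.complexConj L) 2).arithmeticSubgroup) (x : (quasiSplit (↥(maximalRealSubfield L)) L (IsCMField.complexConj L) 2).Adelic),
      Ec z ((γ : (quasiSplit (↥(maximalRealSubfield L)) L (IsCMField.complexConj L) 2).Adelic) * x) = Ec z x)
    (Fp : (quasiSplit (↥(maximalRealSubfield L)) L (IsCMField.complexConj L) 2).Adelic → ℂ → ℂ) (hF : ∀ g, AnalyticAt ℂ (Fp g) 1) (hFE : ∀ g, Fp g =ᶠ[𝓝[≠] 1] fun z => (z - 1) * Ec z g)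
    (c : ℂ)
    (hct : ∀ (ν' : Measure ↥(adelicUnipotent (↥(maximalRealSubfield L)) L (IsCMField.complexConj L) 2)) [ν'.IsHaarMeasure]
      {𝓕' : Set ↥(adelicUnipotent (↥(maximalRealSubfield L)) L (IsCMField.complexConj L) 2)},
      IsFundamentalDomain ↥(rationalUnipotent (↥(maximalRealSubfield L)) L (IsCMField.complexConj L) 2) 𝓕' ν' →
        ∀ x : (quasiSplit (↥(maximalRealSubfield L)) L (IsCMField.complexConj L) 2).Adelic,
          IntegrableOn (fun u : ↥(adelicUnipotent (↥(maximalRealSubfield L)) L (IsCMField.complexConj L) 2) =>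
              Fp ((u : (quasiSplit (↥(maximalRealSubfield L)) L (IsCMField.complexConj L) 2).Adelic) * x) 1 - c) 𝓕' ν' ∧
            ∫ u in 𝓕', (Fp ((u : (quasiSplit (↥(maximalRealSubfield L)) L (IsCMField.complexConj L) 2).Adelic) * x) 1 - c) ∂ν' = 0)
    (Res : (quasiSplit (↥(maximalRealSubfield L)) L (IsCMField.complexConj L) 2).L2 μ)
    (hResae : ((Res : (quasiSplit (↥(maximalRealSubfield L)) L (IsCMField.complexConj L) 2).L2 μ) : (quasiSplit (↥(maximalRealSubfield L)) L (IsCMField.complexConj L) 2).automorphicQuotient → ℂ) =ᵐ[μ] fun x =>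
      Fp (Quotient.out (x : (quasiSplit (↥(maximalRealSubfield L)) L (IsCMField.complexConj L) 2).Adelic ⧸ (quasiSplit (↥(maximalRealSubfield L)) L (IsCMField.complexConj L) 2).quotientSubgroup))⁻¹ 1 -
        if T < supHeight (↥(maximalRealSubfield L)) L (IsCMField.complexConj L) 2 x then c else 0)
    (ind : (quasiSplit (↥(maximalRealSubfield L)) L (IsCMField.complexConj L) 2).L2 μ)
    (hind : ∀ hm : MemLp ((quasiSplit (↥(maximalRealSubfield L)) L (IsCMField.complexConj L) 2).quotFun fun t =>
      if T < supHeight (↥(maximalRealSubfield L)) L (IsCMField.complexConj L) 2 ((quasiSplit (↥(maximalRealSubfield L)) L (IsCMField.complexConj L) 2).toAutomorphicQuotient t⁻¹) then (1 : ℂ) else 0) 2 μ,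
      ind = hm.toLp _)
    (horth : ∀ φ : ↥((quasiSplit (↥(maximalRealSubfield L)) L (IsCMField.complexConj L) 2).cuspForms μ
      (⟨PUnit, fun _ => adelicUnipotent (↥(maximalRealSubfield L)) L (IsCMField.complexConj L) 2⟩ : (quasiSplit (↥(maximalRealSubfield L)) L (IsCMField.complexConj L) 2).ParabolicUnipotentData)),
      ⟪Res + c • ind, (quasiSplit (↥(maximalRealSubfield L)) L (IsCMField.complexConj L) 2).cuspFormsToLp μ
        (⟨PUnit, fun _ => adelicUnipotent (↥(maximalRealSubfield L)) L (IsCMField.complexConj L) 2⟩ : (quasiSplit (↥(maximalRealSubfield L)) L (IsCMField.complexConj L) 2).ParabolicUnipotentData) φ⟫_ℂ = 0) :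
    ∀ g : (quasiSplit (↥(maximalRealSubfield L)) L (IsCMField.complexConj L) 2).Adelic, Fp g 1 = c := by
  haveI := t2Space_adeleRing_of_numberField L
  haveI : T2Space (quasiSplit (↥(maximalRealSubfield L)) L (IsCMField.complexConj L) 2).Adelic :=
    inferInstanceAs (T2Space (adelic (↥(maximalRealSubfield L)) L (IsCMField.complexConj L) 2 ((StdForm.antidiagonal 2).over L)))
  have hD1 : ∀ᶠ z in 𝓝[≠] (1 : ℂ), z ∈ D := by
    filter_upwards [inter_mem_nhdsWithin _ (ball_mem_nhds (1 : ℂ) hρ)] with z hz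
    exact hρD z hz.1 (mem_ball.1 hz.2)
  -- the residue function `R = F · 1`: continuous and left-`G(L⁺)`-invariant
  have hRc : Continuous fun g : (quasiSplit (↥(maximalRealSubfield L)) L (IsCMField.complexConj L) 2).Adelic => Fp g 1 :=
    continuous_residueValue Ec hDo hρ hρD hEd hE4 hEbd Fp hF hFE
  have hRinv : ∀ γ ∈ (quasiSplit (↥(maximalRealSubfield L)) L (IsCMField.complexConj L) 2).quotientSubgroup, ∀ g : (quasiSplit (↥(maximalRealSubfield L)) L (IsCMField.complexConj L) 2).Adelic,
      (fun t : (quasiSplit (↥(maximalRealSubfield L)) L (IsCMField.complexConj L) 2).Adelic => Fp t 1) (γ * g) = (fun t => Fp t 1) g := fun γ hγ g => by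
    rw [quotientSubgroup_quasiSplit] at hγ
    exact residueValue_rational_mul Ec hD1 hEcinv Fp hF hFE ⟨γ, hγ⟩ g
  -- the function `ψ = R̃ − c` on `𝔛`
  set ψ : (quasiSplit (↥(maximalRealSubfield L)) L (IsCMField.complexConj L) 2).automorphicQuotient → ℂ :=
    fun x => (quasiSplit (↥(maximalRealSubfield L)) L (IsCMField.complexConj L) 2).quotFun (fun t => Fp t 1) x - c with hψ
  have hψc : Continuous ψ := (AdelicGroupData.continuous_quotFun hRinv hRc).sub continuous_const
  -- the Siegel indicator class and the residue class `Fres = Res + c • ind`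
  have hm := memLp_quotFun_siegelIndicator (F := (↥(maximalRealSubfield L))) (E := L) (c := (IsCMField.complexConj L)) (N := 2) μ 2 T
  have hind_def : ind = hm.toLp _ := hind hm
  have hind_ae : ((ind : (quasiSplit (↥(maximalRealSubfield L)) L (IsCMField.complexConj L) 2).L2 μ) : (quasiSplit (↥(maximalRealSubfield L)) L (IsCMField.complexConj L) 2).automorphicQuotient → ℂ) =ᵐ[μ]
      fun x => if T < supHeight (↥(maximalRealSubfield L)) L (IsCMField.complexConj L) 2 x then (1 : ℂ) else 0 := by
    filter_upwards [hm.coeFn_toLp] with x hx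
    rw [hind_def, hx]
    change (if T < supHeight (↥(maximalRealSubfield L)) L (IsCMField.complexConj L) 2 ((quasiSplit (↥(maximalRealSubfield L)) L (IsCMField.complexConj L) 2).toAutomorphicQuotient
      (Quotient.out (x : (quasiSplit (↥(maximalRealSubfield L)) L (IsCMField.complexConj L) 2).Adelic ⧸ (quasiSplit (↥(maximalRealSubfield L)) L (IsCMField.complexConj L) 2).quotientSubgroup))⁻¹⁻¹) then (1 : ℂ) else 0) = _
    rw [inv_inv, show (quasiSplit (↥(maximalRealSubfield L)) L (IsCMField.complexConj L) 2).toAutomorphicQuotient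
      (Quotient.out (x : (quasiSplit (↥(maximalRealSubfield L)) L (IsCMField.complexConj L) 2).Adelic ⧸ (quasiSplit (↥(maximalRealSubfield L)) L (IsCMField.complexConj L) 2).quotientSubgroup)) = x from Quotient.out_eq _]
  -- `ψ` is a.e. the representative of `Res + c • ind − c • 𝟙`
  have hRes_ae := hResae
  set V : (quasiSplit (↥(maximalRealSubfield L)) L (IsCMField.complexConj L) 2).L2 μ :=
    Res + c • ind - c • (Lp.const 2 μ (1 : ℂ) : (quasiSplit (↥(maximalRealSubfield L)) L (IsCMField.complexConj L) 2).L2 μ) with hVdef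
  have hψae : ψ =ᵐ[μ] ((V : (quasiSplit (↥(maximalRealSubfield L)) L (IsCMField.complexConj L) 2).L2 μ) : (quasiSplit (↥(maximalRealSubfield L)) L (IsCMField.complexConj L) 2).automorphicQuotient → ℂ) := by
    filter_upwards [hRes_ae, hind_ae, Lp.coeFn_sub (Res + c • ind) (c • (Lp.const 2 μ (1 : ℂ) : (quasiSplit (↥(maximalRealSubfield L)) L (IsCMField.complexConj L) 2).L2 μ)),
      Lp.coeFn_add Res (c • ind), Lp.coeFn_smul c ind, Lp.coeFn_smul c (Lp.const 2 μ (1 : ℂ) : (quasiSplit (↥(maximalRealSubfield L)) L (IsCMField.complexConj L) 2).L2 μ),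
      Lp.coeFn_const 2 μ (1 : ℂ)] with x hR hI hsub hadd hsm1 hsm2 h1
    rw [hVdef, hsub, Pi.sub_apply, hadd, Pi.add_apply, hsm1, Pi.smul_apply, hsm2, Pi.smul_apply, hR, hI, h1, hψ]
    simp only [Function.const_apply, smul_eq_mul, mul_one]
    change Fp (Quotient.out (x : (quasiSplit (↥(maximalRealSubfield L)) L (IsCMField.complexConj L) 2).Adelic ⧸ (quasiSplit (↥(maximalRealSubfield L)) L (IsCMField.complexConj L) 2).quotientSubgroup))⁻¹ 1 - c = _
    split_ifs <;> ring
  have hψ2 : MemLp ψ 2 μ := (Lp.memLp V).ae_eq hψae.symm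
  have hVψ : hψ2.toLp ψ = V := by
    refine Lp.ext ?_
    filter_upwards [hψ2.coeFn_toLp, hψae] with x hx hx'
    rw [hx, hx']
  -- the one-radical parabolic datum `𝔓₀ = (N(𝔸))` and the cusp condition of `ψ`
  have hB0 : @BorelSpace ↥(adelicUnipotent (↥(maximalRealSubfield L)) L (IsCMField.complexConj L) 2) _ Subtype.instMeasurableSpace := inferInstance
  have hCT : ConstantTermVanishes (⟨PUnit, fun _ => adelicUnipotent (↥(maximalRealSubfield L)) L (IsCMField.complexConj L) 2⟩ :
      (quasiSplit (↥(maximalRealSubfield L)) L (IsCMField.complexConj L) 2).ParabolicUnipotentData) ψ PUnit.unit := by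
    intro m hB ν' hν' 𝓕' h𝓕' x
    have hmeq : m = Subtype.instMeasurableSpace :=
      (@BorelSpace.measurable_eq _ _ m hB).trans (@BorelSpace.measurable_eq _ _ _ hB0).symm
    subst hmeq
    have hx : ∀ u : ↥(adelicUnipotent (↥(maximalRealSubfield L)) L (IsCMField.complexConj L) 2),
        ψ ((quasiSplit (↥(maximalRealSubfield L)) L (IsCMField.complexConj L) 2).toAutomorphicQuotient (x * (u : (quasiSplit (↥(maximalRealSubfield L)) L (IsCMField.complexConj L) 2).Adelic)⁻¹)) =
          Fp ((u : (quasiSplit (↥(maximalRealSubfield L)) L (IsCMField.complexConj L) 2).Adelic) * x⁻¹) 1 - c := fun u => by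
      rw [hψ]
      change (quasiSplit (↥(maximalRealSubfield L)) L (IsCMField.complexConj L) 2).quotFun (fun t => Fp t 1) _ - c = _
      rw [AdelicGroupData.quotFun_toAutomorphicQuotient hRinv, mul_inv_rev, inv_inv]
    simp_rw [hx]
    haveI := hν'
    exact hct ν' h𝓕' x⁻¹
  have hψmem : ψ ∈ (quasiSplit (↥(maximalRealSubfield L)) L (IsCMField.complexConj L) 2).cuspForms μ
      (⟨PUnit, fun _ => adelicUnipotent (↥(maximalRealSubfield L)) L (IsCMField.complexConj L) 2⟩ : (quasiSplit (↥(maximalRealSubfield L)) L (IsCMField.complexConj L) 2).ParabolicUnipotentData) :=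
    ⟨hψc, hψ2, fun _ => hCT⟩
  -- `[ψ] ⊥` every cusp form (★ (P-orth)) and `⊥ 𝟙` (★ ROAD B mean zero): `‖[ψ]‖² = 0`
  have horth := horth ⟨ψ, hψmem⟩
  have hmean := integral_eq_zero_of_mem_cuspForms_cm_two L μ
    (⟨PUnit, fun _ => adelicUnipotent (↥(maximalRealSubfield L)) L (IsCMField.complexConj L) 2⟩ : (quasiSplit (↥(maximalRealSubfield L)) L (IsCMField.complexConj L) 2).ParabolicUnipotentData)
    PUnit.unit rfl ψ hψmem
  have hΨ : (quasiSplit (↥(maximalRealSubfield L)) L (IsCMField.complexConj L) 2).cuspFormsToLp μ _ ⟨ψ, hψmem⟩ = V := by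
    rw [AdelicGroupData.cuspFormsToLp_apply, ← hVψ]
  rw [hΨ] at horth
  have h1 : ⟪(Lp.const 2 μ (1 : ℂ) : (quasiSplit (↥(maximalRealSubfield L)) L (IsCMField.complexConj L) 2).L2 μ), V⟫_ℂ = 0 := by
    rw [inner_const_one_left, ← hVψ, integral_congr_ae hψ2.coeFn_toLp, hmean]
  have hV0 : V = 0 := by
    rw [← inner_self_eq_zero (𝕜 := ℂ)]
    have h : ⟪V, V⟫_ℂ = ⟪Res + c • ind, V⟫_ℂ - conj c * ⟪(Lp.const 2 μ (1 : ℂ) : (quasiSplit (↥(maximalRealSubfield L)) L (IsCMField.complexConj L) 2).L2 μ), V⟫_ℂ := by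
      rw [hVdef, inner_sub_left, inner_smul_left]
    rw [h, horth, h1, mul_zero, sub_zero]
  -- `ψ = 0` a.e., hence everywhere (continuity; automorphic measures charge open sets)
  have hψ0 : ψ = 0 := by
    have hae : ψ =ᵐ[μ] (0 : (quasiSplit (↥(maximalRealSubfield L)) L (IsCMField.complexConj L) 2).automorphicQuotient → ℂ) := by
      have h := hψae
      rw [hV0] at h
      exact h.trans (Lp.coeFn_zero ℂ 2 μ)
    exact (Continuous.ae_eq_iff_eq μ hψc continuous_const).1 hae
  intro g
  have h := congrFun hψ0 ((quasiSplit (↥(maximalRealSubfield L)) L (IsCMField.complexConj L) 2).toAutomorphicQuotient g⁻¹)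
  rw [hψ, Pi.zero_apply] at h
  change (quasiSplit (↥(maximalRealSubfield L)) L (IsCMField.complexConj L) 2).quotFun (fun t => Fp t 1) _ - c = 0 at h
  rwa [AdelicGroupData.quotFun_toAutomorphicQuotient hRinv, inv_inv, sub_eq_zero] at h

/-! ## §2 The `det`-twisted residue from the same letters -/

-- same letter package plus the twisted pole letter
/-- **R5 AT EVERY LEVEL, TWISTED**: under the three letters for `Ẽ` (so that `Res_{z=1} Ẽ(z)(g) = c`, §1), for an automorphic character `Θ` of `U(Φ₂)(𝔸)` and ANY pole letter
`(Fp′, hF′, hFE′)` of the twisted family `z ↦ Ẽ(z)·Θ`: `Fp′ g 1 = c · Θ(g)` — «`Res_{z=1} E(φ₁·(ψ∘det), z) = c(φ₁)·(ψ∘det)`» (★ p861657 `residue_twist`).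
[cite: Rogawski1990, §13.3 p. 202] [cite: MoeglinWaldspurger1995, IV.1.11] -/
theorem residue_detTwist_eq_const_mul_of_letters_cm_two
    (μ : Measure (quasiSplit (↥(maximalRealSubfield L)) L (IsCMField.complexConj L) 2).automorphicQuotient) [(quasiSplit (↥(maximalRealSubfield L)) L (IsCMField.complexConj L) 2).IsAutomorphicMeasure μ]
    {T : ℝ≥0}
    (Ec : ℂ → (quasiSplit (↥(maximalRealSubfield L)) L (IsCMField.complexConj L) 2).Adelic → ℂ) {D : Set ℂ} (hDo : IsOpen D)
    {ρ : ℝ} (hρ : 0 < ρ) (hρD : ∀ z : ℂ, z ≠ 1 → dist z 1 < ρ → z ∈ D)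
    (hEd : ∀ g, DifferentiableOn ℂ (fun z => Ec z g) D) (hE4 : ∀ z ∈ D, Continuous (Ec z))
    (hEbd : ∀ z₀ ∈ D, ∀ K : Set (quasiSplit (↥(maximalRealSubfield L)) L (IsCMField.complexConj L) 2).Adelic, IsCompact K → ∃ V ∈ 𝓝 z₀, ∃ M : ℝ, ∀ z ∈ V, ∀ g ∈ K, ‖Ec z g‖ ≤ M)
    (hEcinv : ∀ z ∈ D, ∀ (γ : (quasiSplit (↥(maximalRealSubfield L)) L (IsCMField.complexConj L) 2).arithmeticSubgroup) (x : (quasiSplit (↥(maximalRealSubfield L)) L (IsCMField.complexConj L) 2).Adelic),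
      Ec z ((γ : (quasiSplit (↥(maximalRealSubfield L)) L (IsCMField.complexConj L) 2).Adelic) * x) = Ec z x)
    (Fp : (quasiSplit (↥(maximalRealSubfield L)) L (IsCMField.complexConj L) 2).Adelic → ℂ → ℂ) (hF : ∀ g, AnalyticAt ℂ (Fp g) 1) (hFE : ∀ g, Fp g =ᶠ[𝓝[≠] 1] fun z => (z - 1) * Ec z g)
    (c : ℂ)
    (hct : ∀ (ν' : Measure ↥(adelicUnipotent (↥(maximalRealSubfield L)) L (IsCMField.complexConj L) 2)) [ν'.IsHaarMeasure]
      {𝓕' : Set ↥(adelicUnipotent (↥(maximalRealSubfield L)) L (IsCMField.complexConj L) 2)},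
      IsFundamentalDomain ↥(rationalUnipotent (↥(maximalRealSubfield L)) L (IsCMField.complexConj L) 2) 𝓕' ν' →
        ∀ x : (quasiSplit (↥(maximalRealSubfield L)) L (IsCMField.complexConj L) 2).Adelic,
          IntegrableOn (fun u : ↥(adelicUnipotent (↥(maximalRealSubfield L)) L (IsCMField.complexConj L) 2) =>
              Fp ((u : (quasiSplit (↥(maximalRealSubfield L)) L (IsCMField.complexConj L) 2).Adelic) * x) 1 - c) 𝓕' ν' ∧
            ∫ u in 𝓕', (Fp ((u : (quasiSplit (↥(maximalRealSubfield L)) L (IsCMField.complexConj L) 2).Adelic) * x) 1 - c) ∂ν' = 0)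
    (Res : (quasiSplit (↥(maximalRealSubfield L)) L (IsCMField.complexConj L) 2).L2 μ)
    (hResae : ((Res : (quasiSplit (↥(maximalRealSubfield L)) L (IsCMField.complexConj L) 2).L2 μ) : (quasiSplit (↥(maximalRealSubfield L)) L (IsCMField.complexConj L) 2).automorphicQuotient → ℂ) =ᵐ[μ] fun x =>
      Fp (Quotient.out (x : (quasiSplit (↥(maximalRealSubfield L)) L (IsCMField.complexConj L) 2).Adelic ⧸ (quasiSplit (↥(maximalRealSubfield L)) L (IsCMField.complexConj L) 2).quotientSubgroup))⁻¹ 1 -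
        if T < supHeight (↥(maximalRealSubfield L)) L (IsCMField.complexConj L) 2 x then c else 0)
    (ind : (quasiSplit (↥(maximalRealSubfield L)) L (IsCMField.complexConj L) 2).L2 μ)
    (hind : ∀ hm : MemLp ((quasiSplit (↥(maximalRealSubfield L)) L (IsCMField.complexConj L) 2).quotFun fun t =>
      if T < supHeight (↥(maximalRealSubfield L)) L (IsCMField.complexConj L) 2 ((quasiSplit (↥(maximalRealSubfield L)) L (IsCMField.complexConj L) 2).toAutomorphicQuotient t⁻¹) then (1 : ℂ) else 0) 2 μ,
      ind = hm.toLp _)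
    (horth : ∀ φ : ↥((quasiSplit (↥(maximalRealSubfield L)) L (IsCMField.complexConj L) 2).cuspForms μ
      (⟨PUnit, fun _ => adelicUnipotent (↥(maximalRealSubfield L)) L (IsCMField.complexConj L) 2⟩ : (quasiSplit (↥(maximalRealSubfield L)) L (IsCMField.complexConj L) 2).ParabolicUnipotentData)),
      ⟪Res + c • ind, (quasiSplit (↥(maximalRealSubfield L)) L (IsCMField.complexConj L) 2).cuspFormsToLp μ
        (⟨PUnit, fun _ => adelicUnipotent (↥(maximalRealSubfield L)) L (IsCMField.complexConj L) 2⟩ : (quasiSplit (↥(maximalRealSubfield L)) L (IsCMField.complexConj L) 2).ParabolicUnipotentData) φ⟫_ℂ = 0)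
    (Θ : (quasiSplit (↥(maximalRealSubfield L)) L (IsCMField.complexConj L) 2).AutomorphicCharacter)
    (Fp' : (quasiSplit (↥(maximalRealSubfield L)) L (IsCMField.complexConj L) 2).Adelic → ℂ → ℂ) (hF' : ∀ g, AnalyticAt ℂ (Fp' g) 1)
    (hFE' : ∀ g, Fp' g =ᶠ[𝓝[≠] 1] fun z => (z - 1) * (Ec z g * ((Θ g : ℂˣ) : ℂ))) :
    ∀ g : (quasiSplit (↥(maximalRealSubfield L)) L (IsCMField.complexConj L) 2).Adelic, Fp' g 1 = c * ((Θ g : ℂˣ) : ℂ) := fun g => by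
  rw [residue_twist Ec Fp hF hFE (fun x => ((Θ x : ℂˣ) : ℂ)) Fp' hF' hFE' g,
    residueValue_eq_const_of_letters_cm_two L μ Ec hDo hρ hρD hEd hE4 hEbd hEcinv Fp hF hFE c hct Res hResae ind hind horth g]

end Summit.HodgeConjecture.HodgeConjecture.Cruxes.H413.K2E1EisensteinResidueLevelConstantU2

end
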